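import Literature.Probability.Percolation.Crossings
import Literature.Probability.Percolation.TriCrossingSandwich
import Literature.Probability.Percolation.BoxCrossingProofs
import Literature.Probability.LatticeModels.MeshDomainBigComponents

/-!
# Deterministic sandwich of G02 crossing events between two domains in mixed position

Support file for `RectilinearSuffices` (route CardyBoundaryCoulombGas of `CardyFormulaZ2`,
item stmt-CriticalPhenomena-5663): the combinatorial core of the inner/outer approximation of a
conformal rectangle by rectilinear ones.

Two planar domains `Ω'` (the *lower* domain) and `Ω''` (the *upper* domain) are in **mixed
position** when `closure Ω' ⊆ Ω'' ∪ F₀ ∪ F₂` for two closed sets `F₀, F₂` off `Ω''` which are far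
from each other, `F₀` being far from `∂Ω'' ∖ A₀''` and `F₂` far from `∂Ω'' ∖ A₂''` (so that `Ω'`
sticks out of `Ω''` only across the two arcs `A₀'', A₂''` of `Ω''`). If moreover the discrete arcs
of `Ω'` to be joined lie in `F₀` and `F₂`, then **every open crossing of `Ω'_δ` between its two
discrete arcs contains an open crossing of `Ω''_δ` between the discrete arcs of `A₀''` and `A₂''`**
(`discreteCrossing_subset_of_mixed`), for the tree's discretisation `discreteCrossing`
(largest mesh component `meshDomain`, discrete arcs `discreteArc`, Smirnov 2001 §2). The only
non-combinatorial input is the *bulk hypothesis* `hbulk` (lattice points of `closure Ω'` at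
distance `≥ ε` from `F₀ ∪ F₂` lie in the largest component of `Ω''_δ`), discharged for Jordan
domains by `JordanDomain.exists_forall_mem_meshDomain_and_reachable` in the geometric wrapper.

Proof: run extraction (`PathIn.exists_run` of `TriCrossingSandwich.lean`, Bollobás–Riordan 2006
Ch. 7 Claim 19 for the triangular lattice) applied to the open `Ω'_δ`-path, with inside steps =
mesh steps of `Ω''` between points of `Ω''`, `L₀`/`L₂`-steps = steps whose closed mesh edge meets
`F₀`/`F₂`; the extracted inside run is long (it joins the `δ`-neighbourhood of `F₀` to that of
`F₂`), hence meets the bulk and lies in `meshDomain Ω'' δ`; its end steps make its ends boundary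
vertices of `Ω''_δ` within `δ` of `A₀''`, `A₂''` and at distance `> 3δ` from the rest of `∂Ω''`.
-/

noncomputable section

namespace Summit.CriticalPhenomena.CardyFormulaZ2.Theorems

open Set Metric
open Literature.Probability.LatticeModels Literature.Probability.Percolation

/-- `meshDomain Ω δ` is a union of whole mesh components: a mesh neighbour (inside `Ω`) of a
vertex of `Ω_δ` is a vertex of `Ω_δ`. [folklore] -/
theorem mem_meshDomain_of_meshGraph_adj {Ω : Set ℂ} {δ : ℝ} {x y : Site 2}
    (hx : x ∈ meshDomain Ω δ) (hy : meshPoint δ y ∈ Ω) (h : (meshGraph Ω δ).Adj x y) :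
    y ∈ meshDomain Ω δ := by
  have hxv : x ∈ meshVertices Ω δ := meshDomain_subset_meshVertices Ω δ hx
  have hadj : (meshVertexGraph Ω δ).Adj ⟨x, hxv⟩ ⟨y, hy⟩ := by
    simp only [SimpleGraph.comap_adj, Function.Embedding.coe_subtype]
    exact h
  exact mem_meshDomain_of_reachable_meshVertexGraph hx hxv hy hadj.reachable

/-- A point of the closed segment `[a, b]` is within `dist a b` of `b`. [folklore] -/
theorem dist_le_of_mem_segment_right {a b p : ℂ} (hp : p ∈ segment ℝ a b) :
    dist p b ≤ dist a b :=
  mem_closedBall.1 (segment_subset_closedBall_right a b hp)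

/-- A point of the closed segment `[a, b]` is within `dist a b` of `a`. [folklore] -/
theorem dist_le_of_mem_segment_left {a b p : ℂ} (hp : p ∈ segment ℝ a b) :
    dist a p ≤ dist a b := by
  rw [dist_comm a p]
  exact mem_closedBall.1 (segment_subset_closedBall_left a b hp)

/-- Restricting the ambient set of a `PathIn` to a set invariant under its steps. [folklore] -/
theorem pathIn_inter_of_invariant {V : Type*} {H : SimpleGraph V} {S T : Set V} {a b : V}
    (h : PathIn H S a b) (ha : a ∈ T) (hT : ∀ p ∈ S, ∀ q ∈ S, p ∈ T → H.Adj p q → q ∈ T) :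
    PathIn H (S ∩ T) a b := by
  obtain ⟨haS, hr⟩ := h
  refine ⟨⟨haS, ha⟩, ?_⟩
  induction hr with
  | refl => exact Relation.ReflTransGen.refl
  | @tail p q hap hpq ih =>
    have hp : p ∈ S ∩ T := PathIn.right_mem (show PathIn H (S ∩ T) a p from ⟨⟨haS, ha⟩, ih⟩)
    exact ih.tail ⟨hpq.1, hpq.2, hT p hp.1 q hpq.2 hp.2 hpq.1⟩

/-- The discrete-arc condition at the end of an extracted run: if `meshPoint δ c ∈ Ω''` is
within `δ` of a point `p` of a set `F` off `Ω''` all of whose points are at distance `> 4δ` from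
`∂Ω'' ∖ A`, then `meshPoint δ c` is at least as close to `A` as to `∂Ω'' ∖ A` (the segment to `p`
leaves `Ω''` through a point of `A`). [folklore] -/
theorem infDist_arc_le_of_near {Ω'' F A : Set ℂ} {δ : ℝ} (hΩ'' : IsOpen Ω'') {c p : ℂ}
    (hc : c ∈ Ω'') (hp : p ∈ F) (hF : Disjoint F Ω'') (hd : dist c p ≤ δ)
    (hFA : ∀ p ∈ F, ∀ q ∈ frontier Ω'' \ A, 4 * δ < dist p q) (hne : (frontier Ω'' \ A).Nonempty) :
    infDist c A ≤ δ ∧ 3 * δ ≤ infDist c (frontier Ω'' \ A) := by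
  have hns : ¬ segment ℝ c p ⊆ Ω'' := fun hs =>
    Set.disjoint_left.1 hF hp (hs (right_mem_segment _ _ _))
  obtain ⟨w, hw, hwf⟩ := exists_mem_segment_frontier hΩ'' hc hns
  have hcw : dist c w ≤ δ := (dist_le_of_mem_segment_left hw).trans hd
  have hpw : dist p w ≤ δ := by
    have := dist_le_of_mem_segment_right hw
    rw [dist_comm] at this
    exact this.trans hd
  have hwA : w ∈ A := by
    by_contra hwA
    have := hFA p hp w ⟨hwf, hwA⟩
    have hδ : 0 ≤ δ := dist_nonneg.trans hcw
    linarith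
  refine ⟨(infDist_le_dist_of_mem hwA).trans hcw, ?_⟩
  by_contra hlt
  push Not at hlt
  obtain ⟨q, hq, hcq⟩ := (infDist_lt_iff hne).1 hlt
  have h4 := hFA p hp q hq
  have htri := dist_triangle p c q
  rw [dist_comm p c] at htri
  linarith

/-- **Sandwich of crossing events for domains in mixed position.** Let `Ω'' ` be open,
`closure Ω' ⊆ Ω'' ∪ F₀ ∪ F₂` with `F₀, F₂` closed and off `Ω''`, points of `F₀` and `F₂` being
`> 2ε + 3δ` apart, points of `F₀` (resp. `F₂`) being `> 4δ` away from `∂Ω'' ∖ A₀''`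
(resp. `∂Ω'' ∖ A₂''`), and suppose the bulk hypothesis at scale `ε ≥ δ` and that the discrete
arcs of `(Ω'; A₀', A₂')` lie in `F₀`, `F₂`. Then every configuration with an open crossing of
`Ω'_δ` from the discrete arc of `A₀'` to that of `A₂'` has an open crossing of `Ω''_δ` from the
discrete arc of `A₀''` to that of `A₂''`. [folklore] -/
theorem discreteCrossing_subset_of_mixed
    {Ω' Ω'' A0' A2' A0'' A2'' F0 F2 : Set ℂ} {δ ε : ℝ} (hδ : 0 < δ) (hδε : δ ≤ ε)
    (hΩ'' : IsOpen Ω'') (hF0c : IsClosed F0)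
    (hcl : closure Ω' ⊆ Ω'' ∪ F0 ∪ F2) (hF0 : Disjoint F0 Ω'') (hF2 : Disjoint F2 Ω'')
    (hsep : ∀ p ∈ F0, ∀ q ∈ F2, 2 * ε + 3 * δ < dist p q)
    (hA0 : ∀ p ∈ F0, ∀ q ∈ frontier Ω'' \ A0'', 4 * δ < dist p q)
    (hA2 : ∀ p ∈ F2, ∀ q ∈ frontier Ω'' \ A2'', 4 * δ < dist p q)
    (hne0 : (frontier Ω'' \ A0'').Nonempty) (hne2 : (frontier Ω'' \ A2'').Nonempty)
    (hbulk : ∀ z : Site 2, meshPoint δ z ∈ closure Ω' → meshPoint δ z ∈ Ω'' →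
      ε ≤ infDist (meshPoint δ z) F0 → ε ≤ infDist (meshPoint δ z) F2 → z ∈ meshDomain Ω'' δ)
    (hstart : ∀ x ∈ discreteArc Ω' δ A0', meshPoint δ x ∈ F0)
    (hend : ∀ y ∈ discreteArc Ω' δ A2', meshPoint δ y ∈ F2) :
    discreteCrossing Ω' δ A0' A2' ⊆ discreteCrossing Ω'' δ A0'' A2'' := by
  intro ω hω
  obtain ⟨x, hx, y, hy, hxy⟩ := hω
  have hxF : meshPoint δ x ∈ F0 := hstart x hx
  have hyF : meshPoint δ y ∈ F2 := hend y hy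
  have habs : |δ| = δ := abs_of_pos hδ
  -- the graphs and the step kinds
  set G : SimpleGraph (Site 2) := openGraph ω ⊓ discreteDomainGraph Ω' δ with hG
  let I : SimpleGraph (Site 2) :=
    { Adj := fun a b => (meshGraph Ω'' δ).Adj a b ∧ meshPoint δ a ∈ Ω'' ∧ meshPoint δ b ∈ Ω''
      symm := ⟨fun a b h => ⟨h.1.symm, h.2.2, h.2.1⟩⟩
      loopless := ⟨fun a h => h.1.ne rfl⟩ }
  set H : SimpleGraph (Site 2) := G ⊓ I with hH
  set L₀ : Site 2 → Site 2 → Prop :=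
    fun a b => ∃ p ∈ segment ℝ (meshPoint δ a) (meshPoint δ b), p ∈ F0 with hL₀
  set L₂ : Site 2 → Site 2 → Prop :=
    fun a b => ∃ p ∈ segment ℝ (meshPoint δ a) (meshPoint δ b), p ∈ F2 with hL₂
  have infAdj : ∀ {K K' : SimpleGraph (Site 2)} {a b : Site 2},
      (K ⊓ K').Adj a b ↔ K.Adj a b ∧ K'.Adj a b := fun {K K' a b} => SimpleGraph.inf_adj K K' a b
  -- unfolding a `G`-step
  have hGadj : ∀ {a b : Site 2}, G.Adj a b → (zdGraph 2).Adj a b ∧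
      segment ℝ (meshPoint δ a) (meshPoint δ b) ⊆ closure Ω' ∧
      a ∈ meshDomain Ω' δ ∧ b ∈ meshDomain Ω' δ ∧ s(a, b) ∈ ω := by
    intro a b h
    have h1 : (openGraph ω).Adj a b := (infAdj.1 h).1
    have h2 : (discreteDomainGraph Ω' δ).Adj a b := (infAdj.1 h).2
    rw [discreteDomainGraph_adj_iff] at h2
    obtain ⟨hm, ha, hb⟩ := h2
    rw [meshGraph_adj_iff] at hm
    exact ⟨hm.1, hm.2, ha, hb, ((openGraph_adj ω a b).1 h1).1⟩
  have hM'cl : ∀ {a : Site 2}, a ∈ meshDomain Ω' δ → meshPoint δ a ∈ closure Ω' := fun ha =>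
    subset_closure (meshDomain_subset_meshVertices _ _ ha)
  have hdistG : ∀ {a b : Site 2}, G.Adj a b → dist (meshPoint δ a) (meshPoint δ b) = δ :=
    fun h => by rw [dist_meshPoint_of_adj (hGadj h).1, habs]
  -- classification of the steps
  have hclass : ∀ a ∈ (univ : Set (Site 2)), ∀ b ∈ (univ : Set (Site 2)), G.Adj a b →
      H.Adj a b ∨ L₀ a b ∨ L₂ a b := by
    intro a _ b _ hab
    obtain ⟨hzd, hseg, haM, hbM, -⟩ := hGadj hab
    by_cases hI : I.Adj a b
    · exact Or.inl (infAdj.2 ⟨hab, hI⟩)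
    · right
      have key : ∃ p ∈ segment ℝ (meshPoint δ a) (meshPoint δ b), p ∈ F0 ∪ F2 := by
        by_cases ha : meshPoint δ a ∈ Ω''
        · by_cases hb : meshPoint δ b ∈ Ω''
          · have hns : ¬ segment ℝ (meshPoint δ a) (meshPoint δ b) ⊆ closure Ω'' := by
              intro hs
              exact hI ⟨meshGraph_adj_iff.2 ⟨hzd, hs⟩, ha, hb⟩
            obtain ⟨p, hp, hpn⟩ := not_subset.1 hns
            refine ⟨p, hp, ?_⟩
            rcases hcl (hseg hp) with (h | h) | h
            · exact absurd (subset_closure h) hpn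
            · exact Or.inl h
            · exact Or.inr h
          · refine ⟨_, right_mem_segment _ _ _, ?_⟩
            rcases hcl (hM'cl hbM) with (h | h) | h
            · exact absurd h hb
            · exact Or.inl h
            · exact Or.inr h
        · refine ⟨_, left_mem_segment _ _ _, ?_⟩
          rcases hcl (hM'cl haM) with (h | h) | h
          · exact absurd h ha
          · exact Or.inl h
          · exact Or.inr h
      obtain ⟨p, hp, hpF | hpF⟩ := key
      · exact Or.inl ⟨p, hp, hpF⟩
      · exact Or.inr ⟨p, hp, hpF⟩
  -- steps out of `x`, steps into `y`
  have hu : ∀ b ∈ (univ : Set (Site 2)), G.Adj x b → ¬ H.Adj x b ∧ L₀ x b := by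
    intro b _ hxb
    refine ⟨fun h => ?_, ⟨_, left_mem_segment _ _ _, hxF⟩⟩
    exact Set.disjoint_left.1 hF0 hxF (infAdj.1 h).2.2.1
  have hv : ∀ a ∈ (univ : Set (Site 2)), G.Adj a y → ¬ H.Adj a y ∧ ¬ L₀ a y := by
    intro a _ hay
    refine ⟨fun h => Set.disjoint_left.1 hF2 hyF (infAdj.1 h).2.2.2, ?_⟩
    rintro ⟨p, hp, hpF⟩
    have hd : dist p (meshPoint δ y) ≤ δ := (dist_le_of_mem_segment_right hp).trans (hdistG hay).le
    have := hsep p hpF _ hyF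
    linarith
  have huv : x ≠ y := by
    rintro rfl
    have := hsep _ hxF _ hyF
    rw [dist_self] at this
    linarith
  have hP : PathIn G univ x y := by
    refine ⟨mem_univ _, ?_⟩
    have hr := (SimpleGraph.reachable_iff_reflTransGen x y).1 hxy
    exact Relation.ReflTransGen.mono (fun a b (h : G.Adj a b) => (⟨h, mem_univ b⟩ : G.Adj a b ∧ b ∈ univ)) x y hr
  -- run extraction
  obtain ⟨a', a, b, b', -, ha'a, hnH, hL0, hrun, -, hbb', hnHb, -, hL2⟩ :=
    PathIn.exists_run (H := H) (L₀ := L₀) (L₂ := L₂) inf_le_left hclass hu hv huv hP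
  obtain ⟨p0, hp0, hp0F⟩ := hL0
  obtain ⟨q2, hq2, hq2F⟩ := hL2
  have haM' : a ∈ meshDomain Ω' δ := (hGadj ha'a).2.2.2.1
  have hbM' : b ∈ meshDomain Ω' δ := (hGadj hbb').2.2.1
  have hap0 : dist (meshPoint δ a) p0 ≤ δ := by
    have := dist_le_of_mem_segment_right hp0
    rw [dist_comm] at this
    exact this.trans (hdistG ha'a).le
  have hbq2 : dist (meshPoint δ b) q2 ≤ δ := (dist_le_of_mem_segment_left hq2).trans (hdistG hbb').le
  have hδa : infDist (meshPoint δ a) F0 ≤ δ := (infDist_le_dist_of_mem hp0F).trans hap0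
  have hδb : infDist (meshPoint δ b) F2 ≤ δ := (infDist_le_dist_of_mem hq2F).trans hbq2
  -- the run is nontrivial, so its ends are points of `Ω''`
  have hab : a ≠ b := by
    intro h
    rw [← h] at hbq2
    have := hsep p0 hp0F q2 hq2F
    have htri := dist_triangle p0 (meshPoint δ a) q2
    rw [dist_comm p0 (meshPoint δ a)] at htri
    linarith
  have haΩ : meshPoint δ a ∈ Ω'' := by
    obtain ⟨c, -, hac⟩ := PathIn.exists_adj_head hrun hab
    exact (infAdj.1 hac).2.2.1
  have hbΩ : meshPoint δ b ∈ Ω'' := by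
    obtain ⟨c, -, hcb⟩ := PathIn.exists_adj_last hrun hab
    exact (infAdj.1 hcb).2.2.2
  -- `meshDomain Ω'' δ` and its complement are invariant under inside steps
  have hinv : ∀ p ∈ (univ : Set (Site 2)), ∀ q ∈ (univ : Set (Site 2)),
      p ∈ meshDomain Ω'' δ → H.Adj p q → q ∈ meshDomain Ω'' δ := by
    intro p _ q _ hp hpq
    have hI := (infAdj.1 hpq).2
    exact mem_meshDomain_of_meshGraph_adj hp hI.2.2 hI.1
  have hinv' : ∀ p ∈ (univ : Set (Site 2)), ∀ q ∈ (univ : Set (Site 2)),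
      p ∈ (meshDomain Ω'' δ)ᶜ → H.Adj p q → q ∈ (meshDomain Ω'' δ)ᶜ := by
    intro p _ q _ hp hpq hq
    have hI := (infAdj.1 hpq).2
    exact hp (mem_meshDomain_of_meshGraph_adj hq hI.2.1 hI.1.symm)
  -- far from `F₀` means close to nothing of `F₂`... : the quantitative separation
  have hF0ne : F0.Nonempty := ⟨_, hxF⟩
  have hF2ne : F2.Nonempty := ⟨_, hyF⟩
  have hfar : ∀ {c : ℂ}, infDist c F0 ≤ ε + 2 * δ → ε + δ ≤ infDist c F2 := by
    intro c hc
    obtain ⟨f0, hf0, hf0d⟩ := hF0c.exists_infDist_eq_dist hF0ne c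
    by_contra hlt
    push Not at hlt
    obtain ⟨f2, hf2, hcf2⟩ := (infDist_lt_iff hF2ne).1 hlt
    have := hsep f0 hf0 f2 hf2
    have htri := dist_triangle f0 c f2
    rw [dist_comm f0 c, ← hf0d] at htri
    linarith
  -- the start of the run lies in the bulk component of `Ω''_δ`
  have haM : a ∈ meshDomain Ω'' δ := by
    by_contra haM
    have hrun' : PathIn H (univ ∩ (meshDomain Ω'' δ)ᶜ) a b := pathIn_inter_of_invariant hrun haM hinv'
    set R : Set (Site 2) := {w | infDist (meshPoint δ w) F0 ≤ ε + δ} with hR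
    have haR : a ∈ R := by
      show infDist (meshPoint δ a) F0 ≤ ε + δ
      linarith
    have hbR : b ∉ R := by
      intro hb
      have hb' : infDist (meshPoint δ b) F0 ≤ ε + δ := hb
      have h1 : ε + δ ≤ infDist (meshPoint δ b) F2 := hfar (by linarith)
      linarith
    obtain ⟨c, d, hcR, hdR, hdT, hcd, -⟩ := hrun'.exit haR hbR
    have hI := (infAdj.1 hcd).2
    have hGcd := (infAdj.1 hcd).1
    have hdist : dist (meshPoint δ d) (meshPoint δ c) = δ := by rw [dist_comm]; exact hdistG hGcd
    have hd0 : infDist (meshPoint δ d) F0 ≤ ε + 2 * δ := by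
      have := infDist_le_infDist_add_dist (x := meshPoint δ d) (y := meshPoint δ c) (s := F0)
      have hc' : infDist (meshPoint δ c) F0 ≤ ε + δ := hcR
      linarith
    have hd0' : ε ≤ infDist (meshPoint δ d) F0 := by
      have : ¬ infDist (meshPoint δ d) F0 ≤ ε + δ := hdR
      linarith
    have hd2 : ε ≤ infDist (meshPoint δ d) F2 := le_trans (by linarith) (hfar hd0)
    have hdM : d ∈ meshDomain Ω'' δ :=
      hbulk d (hM'cl (hGadj hGcd).2.2.2.1) hI.2.2 hd0' hd2
    exact hdT.2 hdM
  -- hence the whole run lies in `Ω''_δ` and is an open path of `Ω''_δ`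
  have hrunM : PathIn H (univ ∩ meshDomain Ω'' δ) a b := pathIn_inter_of_invariant hrun haM hinv
  have hbM : b ∈ meshDomain Ω'' δ := hrunM.right_mem.2
  have hreach : (openGraph ω ⊓ discreteDomainGraph Ω'' δ).Reachable a b := by
    obtain ⟨-, hr⟩ := hrunM
    clear hrun hbb' hnHb hq2 hbM' hbq2 hδb hab hbΩ hbM
    induction hr with
    | refl => exact SimpleGraph.Reachable.rfl
    | @tail p q hap hpq ih =>
      have hpM : p ∈ meshDomain Ω'' δ :=
        (PathIn.right_mem (show PathIn H (univ ∩ meshDomain Ω'' δ) a p from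
          ⟨⟨mem_univ _, haM⟩, hap⟩)).2
      refine ih.trans (SimpleGraph.Adj.reachable ?_)
      have hG' := (infAdj.1 hpq.1).1
      have hI := (infAdj.1 hpq.1).2
      refine infAdj.2 ⟨(infAdj.1 hG').1, ?_⟩
      rw [discreteDomainGraph_adj_iff]
      exact ⟨hI.1, hpM, hpq.2.2⟩
  -- the ends of the run are boundary vertices of `Ω''_δ`
  have ha_bd : a ∈ meshBoundary Ω'' δ := by
    refine ⟨haM, a', (hGadj ha'a).1.symm, fun h => ?_⟩
    rw [discreteDomainGraph_adj_iff] at h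
    obtain ⟨hm, -, ha'M⟩ := h
    exact hnH (infAdj.2
      ⟨ha'a, ⟨hm.symm, meshDomain_subset_meshVertices _ _ ha'M, haΩ⟩⟩)
  have hb_bd : b ∈ meshBoundary Ω'' δ := by
    refine ⟨hbM, b', (hGadj hbb').1, fun h => ?_⟩
    rw [discreteDomainGraph_adj_iff] at h
    obtain ⟨hm, -, hb'M⟩ := h
    exact hnHb (infAdj.2
      ⟨hbb', ⟨hm, hbΩ, meshDomain_subset_meshVertices _ _ hb'M⟩⟩)
  -- and they belong to the discrete arcs of `A₀''`, `A₂''`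
  have harc_a := infDist_arc_le_of_near hΩ'' haΩ hp0F hF0 hap0 hA0 hne0
  have harc_b := infDist_arc_le_of_near hΩ'' hbΩ hq2F hF2 hbq2 hA2 hne2
  refine ⟨a, ⟨ha_bd, ?_⟩, b, ⟨hb_bd, ?_⟩, hreach⟩
  · exact harc_a.1.trans (le_trans (by linarith) harc_a.2)
  · exact harc_b.1.trans (le_trans (by linarith) harc_b.2)

end Summit.CriticalPhenomena.CardyFormulaZ2.Theorems
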